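import Summits.MatrixMultiplication.OmegaCensus.STPP222PowCyclicThreeAPFree
import Summits.MatrixMultiplication.OmegaCensus.STPPSmallPatternT1Below24
import Summits.MatrixMultiplication.OmegaCensus.STPPSmallPatternT2Below24

/-!
# ω-census, small patterns `(2,1,1)^k` and `(1,2,2)^k`: the 3-AP-free cyclic host law (a law for ALL `k`)

Cell `pub-omega`, ω construction census, seat pub-omega ENG2 (gen 33). HONEST FRAMING (verbatim): lottery ticket; floor =
certified bounds/negative ranges.  Census STRUCTURE bookkeeping for column B5 (`T1(H)` / `T2(H)` = the largest `k` with
`(2,1,1)^k ⊆ H` / `(1,2,2)^k ⊆ H`, CKSU 2005 Def. 5.1, tree `IsSTPP`); nothing here bears on `ω` (thin patterns never beat the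
packing bound).

Until now the cyclic `T1` / `T2` columns of B5 were PER-`k` kernel tables (`STPPSmallPatternCyclicRaysT1*.lean`, `…T2*.lean`, ENG2
gen 32: rays for `k ≤ 13` resp. `k ≤ 8`, bounded by the 128-bit engine).  This file is the thin-pattern companion of stpp-3's
`STPP222PowCyclicThreeAPFree.lean` (`(2,2,2)^k ⊆ ℤ/m ∀ m ≥ 16F + 8`): ONE integer family per pattern, seeded by an injective
`f : Fin k → ℕ` with 3-AP-free range (Mathlib `ThreeAPFree`) and `F = max f`,

* `(2,1,1)`: `Aᵢ = {2fᵢ, 2fᵢ + 1}`, `Bᵢ = {0}`, `Cᵢ = {4fᵢ}` — every Def-5.1 word is `2(fᵢ + f_l − 2fⱼ) + e` with `e ∈ {0, ±1}`,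
  of absolute value `≤ 4F + 1`; if it vanishes in `ℤ/m` with `m ≥ 4F + 2` it vanishes in `ℤ`, so `e = 0` (parity) and
  `fᵢ + f_l = 2fⱼ`, a 3-term progression in the range of `f`, hence trivial (`isSTPP_apFam211`);
* `(1,2,2)`: `Aᵢ = {0}`, `Bᵢ = {8fᵢ, 8fᵢ + 2}`, `Cᵢ = {4fᵢ, 4fᵢ + 1}` — every word is `4(fⱼ + f_l − 2fᵢ) + e₂ + e₃` with
  `e₂ ∈ {0, ±2}`, `e₃ ∈ {0, ±1}`, of absolute value `≤ 8F + 3`; vanishing forces `4 ∣ e₂ + e₃`, so `e₂ = e₃ = 0`, and again a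
  3-term progression (`isSTPP_apFam122`).

(The COMPLETE-mode lex-first families of the gen-32 engine at `T1 k = 12`, `T2 k = 8` ARE these families on the Erdős–Turán base-3 set
`{0,1,3,4,9,10,12,13,…}` — that is how the law was noticed.)  Consequences, all symbolic in `k`:

* `exists_isSTPP_211pow_zmod_of_le_rothNumberNat` / `…122pow…` — **`k ≤ rothNumberNat N` ⇒ `(2,1,1)^k ⊆ ℤ/m ∀ m ≥ 4N − 2` and
  `(1,2,2)^k ⊆ ℤ/m ∀ m ≥ 8N − 4`**; with `n₃(k) = min {N : rothNumberNat N ≥ k} = 2, 4, 5, 9, 11, 13, 14, 20, 24, 26, 30, 32, 36, 40, 41`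
  (`k = 2…16`, OEIS A003002) the `T1` thresholds read `6, 14, 18, 34, 42, 50, 54, 78, 94, 102, 118, 126, 142, 158, 162` — EXACT at
  `k = 2` (`onset 6`) and `k = 4` (cyclic onset `18`), and the first rays anywhere at `k = 14, 15, 16`; the `T2` thresholds
  `12, 28, 36, 68, 84, 100, 108, 156, 188, 204, 236, 252, 284, 316, 324` — exact at `k = 2` (`onset 12`), first rays at `k ≥ 9`;
* `…_of_le_two_pow` — the EXPLICIT law from the base-3 set (tree `Nat.ofDigits 3 (Nat.digits 2 x)`, stpp-3 gen 10):
  **`k ≤ 2^t` ⇒ `(2,1,1)^k ⊆ ℤ/m ∀ m ≥ 2·3^t` and `(1,2,2)^k ⊆ ℤ/m ∀ m ≥ 4·3^t`**, i.e. `onset_T1(k) ≤ 2·3^{⌈log₂ k⌉} < 6·k^{log₂ 3}`,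
  `onset_T2(k) ≤ 4·3^{⌈log₂ k⌉} < 12·k^{log₂ 3}` for every `k ≥ 1` (`k = 2, 4, 8, 16, 32, 64 ↦ 6, 18, 54, 162, 486, 1458` resp. the doubles);
* `…_behrend` — with Mathlib's `Behrend.roth_lower_bound`: for every `N` and every `m ≥ 4N − 2` (resp. `8N − 4`) some
  `k ≥ N·e^{−4√log N}` fits: **`T1(ℤ/m), T2(ℤ/m) ≥ m^{1−o(1)}`** — the linear packing laws (`4k ≤ m + 2`, `6k ≤ m + 2`, filter N9) are
  sharp up to `m^{o(1)}` in CYCLIC groups (contrast: the power saving in bounded exponent, `STPPElementaryLowerLaw.lean`);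
* transports `…_of_addOrderOf_…` (any abelian group with an element of large order, e.g. exponent `≥ 2·3^t`).  The explicit rungs
  `k = 9 … 16` (Salem–Spencer seeds; `(2,1,1)¹³ ∀ m ≥ 118` with gen 32's hosts, `(2,1,1)¹⁴ ∀ m ≥ 142`, …, `(1,2,2)⁹ ∀ m ≥ 156`, …) are the
  companion file `STPPSmallPatternCyclicThreeAPFreeRungs.lean`.

No sharpness is claimed anywhere (e.g. `k = 8` gives `m ≥ 54` while the kernel ray starts at `48`, `…CyclicRaysT1K8`).  The idea of
seeding a simultaneous product property with a 3-AP-free set is CKSU 2005's (Lemma 35); Salem–Spencer / Behrend sets enter matrix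
multiplication in Coppersmith–Winograd 1990.  References: H. Cohn, R. Kleinberg, B. Szegedy, C. Umans, FOCS 2005 (arXiv:math/0511460),
Def. 5.1, Lemma 35; P. Erdős, P. Turán, J. London Math. Soc. 11 (1936) 261–264; F. Behrend, Proc. Nat. Acad. Sci. 32 (1946) 331–332
(via Mathlib).  Seat pub-omega ENG2 (gen 33), 2026-08-28.
-/

open Literature.Computability.AlgebraicComplexity Finset

namespace Summit.MatrixMultiplication.OmegaCensus

/-! ## Pattern `(2,1,1)`: arithmetic core (integers) -/

/-- Size bound for the `(2,1,1)` family: for `FI, FJ, FL ≥ 0` with `4F + 2 ≤ M` and `e ∈ {0, ±1}`, the word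
`(2FI − 2FL + e) + (4FL − 4FJ)` lies strictly between `−M` and `M`. -/
theorem apFam211_expr_bound (FI FJ FL e M : ℤ) (hI : 0 ≤ FI) (hJ : 0 ≤ FJ) (hL : 0 ≤ FL)
    (hIM : 4 * FI + 2 ≤ M) (hJM : 4 * FJ + 2 ≤ M) (hLM : 4 * FL + 2 ≤ M) (h1 : e = -1 ∨ e = 0 ∨ e = 1) :
    -M < (2 * FI - 2 * FL + e) + (4 * FL - 4 * FJ) ∧ (2 * FI - 2 * FL + e) + (4 * FL - 4 * FJ) < M := by
  constructor <;> omega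

/-- Digit argument for the `(2,1,1)` family: if the word vanishes then `e = 0` (parity) and `FI + FL = 2FJ`. -/
theorem apFam211_expr_eq_zero (FI FJ FL e : ℤ) (h1 : e = -1 ∨ e = 0 ∨ e = 1)
    (h : (2 * FI - 2 * FL + e) + (4 * FL - 4 * FJ) = 0) : FI + FL = FJ + FJ ∧ e = 0 := by
  omega

/-! ## Pattern `(2,1,1)`: the STPP property in `ZMod m` -/

/-- **The 3-AP-free `(2,1,1)` family `Aᵢ = {2fᵢ, 2fᵢ+1}`, `Bᵢ = {0}`, `Cᵢ = {4fᵢ}` is an STPP family in `ZMod m` whenever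
`4fᵢ + 2 ≤ m` for all `i`.**  The `A`-difference is lifted to an integer (`diff_of_mem_pair`); the vanishing residue is a multiple of
`m` of absolute value `< m` (`apFam211_expr_bound`), hence the integer word vanishes; `apFam211_expr_eq_zero` gives the progression
`fᵢ + f_l = 2fⱼ` in the range of `f`, which `ThreeAPFree` makes trivial, and injectivity of `f` gives `i = j = l`.
[cite: CohnKleinbergSzegedyUmans2005, Def. 5.1] -/
theorem isSTPP_apFam211 (m k : ℕ) (f : Fin k → ℕ) (hf : Function.Injective f) (hap : ThreeAPFree (Set.range f))
    (hm : ∀ i, 4 * f i + 2 ≤ m) :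
    IsSTPP (fun i : Fin k => pairZ m (2 * ((f i : ℕ) : ℤ)) 1) (fun _ => ({0} : Finset (ZMod m)))
      (fun i => ({(((4 * ((f i : ℕ) : ℤ) : ℤ)) : ZMod m)} : Finset (ZMod m))) := by
  intro i j l s hs s' hs' t ht t' ht' u hu u' hu' heq
  simp only [pairZ, Finset.mem_insert, Finset.mem_singleton] at hs hs' ht ht' hu hu'
  obtain ⟨e, he, hd, hq⟩ := diff_of_mem_pair hs hs'
  subst ht ht' hu hu'
  rw [hd] at heq
  have hE : (((2 * ((f i : ℕ) : ℤ) - 2 * ((f l : ℕ) : ℤ) + e) + (4 * ((f l : ℕ) : ℤ) - 4 * ((f j : ℕ) : ℤ)) : ℤ) :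
      ZMod m) = 0 := by
    rw [← heq]; push_cast; ring
  rw [ZMod.intCast_zmod_eq_zero_iff_dvd] at hE
  have hIM : 4 * ((f i : ℕ) : ℤ) + 2 ≤ m := by exact_mod_cast hm i
  have hJM : 4 * ((f j : ℕ) : ℤ) + 2 ≤ m := by exact_mod_cast hm j
  have hLM : 4 * ((f l : ℕ) : ℤ) + 2 ≤ m := by exact_mod_cast hm l
  have hb := apFam211_expr_bound (f i) (f j) (f l) e m (by positivity) (by positivity) (by positivity) hIM hJM hLM he
  have hz : (2 * ((f i : ℕ) : ℤ) - 2 * ((f l : ℕ) : ℤ) + e) + (4 * ((f l : ℕ) : ℤ) - 4 * ((f j : ℕ) : ℤ)) = (0 : ℤ) := by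
    apply Int.eq_zero_of_dvd_of_natAbs_lt_natAbs hE
    simp only [Int.natAbs_natCast]
    omega
  obtain ⟨hap', r1⟩ := apFam211_expr_eq_zero (f i) (f j) (f l) e he hz
  have hsum : f i + f l = f j + f j := by exact_mod_cast hap'
  have hij : f i = f j := hap (Set.mem_range_self i) (Set.mem_range_self j) (Set.mem_range_self l) hsum
  have hlj : f l = f j := by omega
  have hij' : i = j := hf hij
  have hjl' : j = l := (hf hlj).symm
  subst hij' hjl'
  exact ⟨rfl, rfl, hq r1 rfl, rfl, rfl⟩

/-- **For every injective `f : Fin k → ℕ` with 3-AP-free range and every `m` with `4fᵢ + 2 ≤ m` for all `i`, `(2,1,1)^k ⊆ ℤ/m`.**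
[cite: CohnKleinbergSzegedyUmans2005, Def. 5.1] -/
theorem exists_isSTPP_211pow_zmod_of_threeAPFree {k m : ℕ} (f : Fin k → ℕ) (hf : Function.Injective f)
    (hap : ThreeAPFree (Set.range f)) (hm : ∀ i, 4 * f i + 2 ≤ m) :
    ∃ A B C : Fin k → Finset (ZMod m), IsSTPP A B C ∧ ∀ i, (A i).card = 2 ∧ (B i).card = 1 ∧ (C i).card = 1 := by
  refine ⟨_, _, _, isSTPP_apFam211 m k f hf hap hm, fun i => ⟨?_, card_singleton _, card_singleton _⟩⟩
  have hm2 : (2 : ℤ) ≤ m := by have := hm i; omega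
  exact card_pairZ _ _ (by norm_num) (by omega)

/-- **`(2,1,1)^k ⊆ ℤ/m` for every `k ≤ rothNumberNat N` and every `m ≥ 4N − 2`** (`rothNumberNat N` = the largest size of a 3-AP-free
subset of `{0,…,N−1}`, Mathlib): enumerate a largest 3-AP-free subset increasingly and keep its first `k` values (all `≤ N − 1`).
Census reading: `onset_T1(k) ≤ 4·n₃(k) − 2`, `n₃(k) = min {N : rothNumberNat N ≥ k}`. [cite: CohnKleinbergSzegedyUmans2005, Def. 5.1] -/
theorem exists_isSTPP_211pow_zmod_of_le_rothNumberNat (N k m : ℕ) (hk : k ≤ rothNumberNat N) (hm : 4 * N ≤ m + 2) :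
    ∃ A B C : Fin k → Finset (ZMod m), IsSTPP A B C ∧ ∀ i, (A i).card = 2 ∧ (B i).card = 1 ∧ (C i).card = 1 := by
  obtain ⟨t, ht, hcard, hap⟩ := rothNumberNat_spec N
  let g : Fin t.card → ℕ := fun i => t.orderEmbOfFin rfl i
  have hg : Function.Injective g := (t.orderEmbOfFin rfl).injective
  have hmem : ∀ i, g i ∈ t := fun i => t.orderEmbOfFin_mem rfl i
  have hkt : k ≤ t.card := hcard ▸ hk
  let f : Fin k → ℕ := fun i => g (Fin.castLE hkt i)
  have hf : Function.Injective f := hg.comp (Fin.castLE_injective hkt)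
  have hrange : Set.range f ⊆ (t : Set ℕ) := by rintro _ ⟨i, rfl⟩; exact hmem _
  have hfm : ∀ i, 4 * f i + 2 ≤ m := fun i => by
    have := ht (hmem (Fin.castLE hkt i)); rw [mem_range] at this
    change 4 * g (Fin.castLE hkt i) + 2 ≤ m
    omega
  exact exists_isSTPP_211pow_zmod_of_threeAPFree f hf (hap.mono hrange) hfm

/-- Transport: **an abelian group with an element of additive order `≥ 4N − 2` admits `(2,1,1)^k` for every `k ≤ rothNumberNat N`.**
[cite: CohnKleinbergSzegedyUmans2005, Def. 5.1] -/
theorem exists_isSTPP_211pow_of_addOrderOf_rothNumberNat {G : Type*} [AddCommGroup G] (N k : ℕ) (g : G)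
    (hk : k ≤ rothNumberNat N) (hg : 4 * N ≤ addOrderOf g + 2) :
    ∃ A B C : Fin k → Finset G, IsSTPP A B C ∧ ∀ i, (A i).card = 2 ∧ (B i).card = 1 ∧ (C i).card = 1 :=
  exists_isSTPP_211_of_injective _ (zmod_lift_zmultiples_injective g)
    (exists_isSTPP_211pow_zmod_of_le_rothNumberNat N k (addOrderOf g) hk hg)

/-- **Cyclic Behrend form `T1(ℤ/m) ≥ m^{1−o(1)}`.** For every `N` and every `m ≥ 4N − 2` there is `k ≥ N·e^{−4√(log N)}` with
`(2,1,1)^k ⊆ ℤ/m` (`k = rothNumberNat N`, Mathlib's `Behrend.roth_lower_bound`).  So the linear packing law for `(2,1,1)` is sharp up to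
a factor `m^{o(1)}` in cyclic groups; no lower bound on onsets is claimed here. [cite: CohnKleinbergSzegedyUmans2005, Def. 5.1] -/
theorem exists_isSTPP_211pow_zmod_behrend (N m : ℕ) (hm : 4 * N ≤ m + 2) :
    ∃ k : ℕ, (N : ℝ) * Real.exp (-4 * √(Real.log N)) ≤ k ∧
      ∃ A B C : Fin k → Finset (ZMod m), IsSTPP A B C ∧ ∀ i, (A i).card = 2 ∧ (B i).card = 1 ∧ (C i).card = 1 :=
  ⟨rothNumberNat N, Behrend.roth_lower_bound, exists_isSTPP_211pow_zmod_of_le_rothNumberNat N _ m le_rfl hm⟩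

/-- **The explicit law: for all `t`, all `k ≤ 2^t` and all `m ≥ 2·3^t`, `(2,1,1)^k ⊆ ℤ/m`** — the family on the Erdős–Turán set
`fᵢ = Nat.ofDigits 3 (Nat.digits 2 i)` (`i < k ≤ 2^t`, values with `2fᵢ + 1 ≤ 3^t`, tree `two_mul_ofDigits_three_digits_two_lt`).
Census reading: `onset_T1(k) ≤ 2·3^{⌈log₂ k⌉} < 6·k^{log₂ 3}`; `k = 2, 4, 8, 16, 32 ↦ m ≥ 6, 18, 54, 162, 486` (kernel onsets `6, 18`; `k = 8`: ray
from `48`). [cite: CohnKleinbergSzegedyUmans2005, Def. 5.1] -/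
theorem exists_isSTPP_211pow_zmod_of_le_two_pow (t k m : ℕ) (hk : k ≤ 2 ^ t) (hm : 2 * 3 ^ t ≤ m) :
    ∃ A B C : Fin k → Finset (ZMod m), IsSTPP A B C ∧ ∀ i, (A i).card = 2 ∧ (B i).card = 1 ∧ (C i).card = 1 := by
  refine exists_isSTPP_211pow_zmod_of_threeAPFree (fun i : Fin k => Nat.ofDigits 3 (Nat.digits 2 (i : ℕ))) ?_ ?_ ?_
  · intro i j h
    exact Fin.ext (eq_of_ofDigits_three_digits_two_add i j i (by simp only at h; omega))
  · rintro _ ⟨a, rfl⟩ _ ⟨b, rfl⟩ _ ⟨c, rfl⟩ h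
    obtain rfl : a = b := Fin.ext (eq_of_ofDigits_three_digits_two_add a b c h)
    rfl
  · intro i
    have := two_mul_ofDigits_three_digits_two_lt t i (lt_of_lt_of_le i.isLt hk)
    change 4 * Nat.ofDigits 3 (Nat.digits 2 (i : ℕ)) + 2 ≤ m
    omega

/-- Transport of the explicit law: **an abelian group with an element of additive order `≥ 2·3^t` admits `(2,1,1)^k` for every `k ≤ 2^t`**
(in particular every finite abelian group of exponent `≥ 2·3^t`). [cite: CohnKleinbergSzegedyUmans2005, Def. 5.1] -/
theorem exists_isSTPP_211pow_of_addOrderOf_two_pow {G : Type*} [AddCommGroup G] (t k : ℕ) (g : G) (hk : k ≤ 2 ^ t)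
    (hg : 2 * 3 ^ t ≤ addOrderOf g) :
    ∃ A B C : Fin k → Finset G, IsSTPP A B C ∧ ∀ i, (A i).card = 2 ∧ (B i).card = 1 ∧ (C i).card = 1 :=
  exists_isSTPP_211_of_injective _ (zmod_lift_zmultiples_injective g)
    (exists_isSTPP_211pow_zmod_of_le_two_pow t k (addOrderOf g) hk hg)

/-! ## Pattern `(1,2,2)`: arithmetic core (integers) -/

/-- Size bound for the `(1,2,2)` family: for `FI, FJ, FL ≥ 0` with `8F + 4 ≤ M`, `e₂ ∈ {0, ±2}`, `e₃ ∈ {0, ±1}`, the word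
`(8FJ − 8FI + e₂) + (4FL − 4FJ + e₃)` lies strictly between `−M` and `M`. -/
theorem apFam122_expr_bound (FI FJ FL e₂ e₃ M : ℤ) (hI : 0 ≤ FI) (hJ : 0 ≤ FJ) (hL : 0 ≤ FL)
    (hIM : 8 * FI + 4 ≤ M) (hJM : 8 * FJ + 4 ≤ M) (hLM : 8 * FL + 4 ≤ M)
    (h2 : e₂ = -2 ∨ e₂ = 0 ∨ e₂ = 2) (h3 : e₃ = -1 ∨ e₃ = 0 ∨ e₃ = 1) :
    -M < (8 * FJ - 8 * FI + e₂) + (4 * FL - 4 * FJ + e₃) ∧ (8 * FJ - 8 * FI + e₂) + (4 * FL - 4 * FJ + e₃) < M := by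
  constructor <;> omega

/-- Digit argument for the `(1,2,2)` family: if the word vanishes then `e₂ = e₃ = 0` (`4 ∣ e₂ + e₃`, `|e₂ + e₃| ≤ 3`, `|e₂| ≠ |e₃|`
unless both vanish) and `FJ + FL = 2FI`. -/
theorem apFam122_expr_eq_zero (FI FJ FL e₂ e₃ : ℤ) (h2 : e₂ = -2 ∨ e₂ = 0 ∨ e₂ = 2) (h3 : e₃ = -1 ∨ e₃ = 0 ∨ e₃ = 1)
    (h : (8 * FJ - 8 * FI + e₂) + (4 * FL - 4 * FJ + e₃) = 0) : FJ + FL = FI + FI ∧ e₂ = 0 ∧ e₃ = 0 := by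
  omega

/-! ## Pattern `(1,2,2)`: the STPP property in `ZMod m` -/

/-- **The 3-AP-free `(1,2,2)` family `Aᵢ = {0}`, `Bᵢ = {8fᵢ, 8fᵢ+2}`, `Cᵢ = {4fᵢ, 4fᵢ+1}` is an STPP family in `ZMod m` whenever
`8fᵢ + 4 ≤ m` for all `i`** (same mechanism as `isSTPP_apFam211`, with `apFam122_expr_bound` / `apFam122_expr_eq_zero`).
[cite: CohnKleinbergSzegedyUmans2005, Def. 5.1] -/
theorem isSTPP_apFam122 (m k : ℕ) (f : Fin k → ℕ) (hf : Function.Injective f) (hap : ThreeAPFree (Set.range f))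
    (hm : ∀ i, 8 * f i + 4 ≤ m) :
    IsSTPP (fun _ : Fin k => ({0} : Finset (ZMod m))) (fun i => pairZ m (8 * ((f i : ℕ) : ℤ)) 2)
      (fun i => pairZ m (4 * ((f i : ℕ) : ℤ)) 1) := by
  intro i j l s hs s' hs' t ht t' ht' u hu u' hu' heq
  simp only [pairZ, Finset.mem_insert, Finset.mem_singleton] at hs hs' ht ht' hu hu'
  obtain ⟨e₂, he₂, hd₂, hq₂⟩ := diff_of_mem_pair ht ht'
  obtain ⟨e₃, he₃, hd₃, hq₃⟩ := diff_of_mem_pair hu hu'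
  subst hs hs'
  rw [hd₂, hd₃] at heq
  have hE : ((((8 * ((f j : ℕ) : ℤ) - 8 * ((f i : ℕ) : ℤ) + e₂) + (4 * ((f l : ℕ) : ℤ) - 4 * ((f j : ℕ) : ℤ) + e₃)) : ℤ) :
      ZMod m) = 0 := by
    rw [← heq]; push_cast; ring
  rw [ZMod.intCast_zmod_eq_zero_iff_dvd] at hE
  have hIM : 8 * ((f i : ℕ) : ℤ) + 4 ≤ m := by exact_mod_cast hm i
  have hJM : 8 * ((f j : ℕ) : ℤ) + 4 ≤ m := by exact_mod_cast hm j
  have hLM : 8 * ((f l : ℕ) : ℤ) + 4 ≤ m := by exact_mod_cast hm l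
  have hb := apFam122_expr_bound (f i) (f j) (f l) e₂ e₃ m (by positivity) (by positivity) (by positivity) hIM hJM hLM he₂ he₃
  have hz : (8 * ((f j : ℕ) : ℤ) - 8 * ((f i : ℕ) : ℤ) + e₂) + (4 * ((f l : ℕ) : ℤ) - 4 * ((f j : ℕ) : ℤ) + e₃) = (0 : ℤ) := by
    apply Int.eq_zero_of_dvd_of_natAbs_lt_natAbs hE
    simp only [Int.natAbs_natCast]
    omega
  obtain ⟨hap', r2, r3⟩ := apFam122_expr_eq_zero (f i) (f j) (f l) e₂ e₃ he₂ he₃ hz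
  have hsum : f j + f l = f i + f i := by exact_mod_cast hap'
  have hji : f j = f i := hap (Set.mem_range_self j) (Set.mem_range_self i) (Set.mem_range_self l) hsum
  have hli : f l = f i := by omega
  have hij' : i = j := (hf hji).symm
  have hjl' : j = l := hf (hji.trans hli.symm)
  subst hij' hjl'
  exact ⟨rfl, rfl, rfl, hq₂ r2 rfl, hq₃ r3 rfl⟩

/-- **For every injective `f : Fin k → ℕ` with 3-AP-free range and every `m` with `8fᵢ + 4 ≤ m` for all `i`, `(1,2,2)^k ⊆ ℤ/m`.**
[cite: CohnKleinbergSzegedyUmans2005, Def. 5.1] -/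
theorem exists_isSTPP_122pow_zmod_of_threeAPFree {k m : ℕ} (f : Fin k → ℕ) (hf : Function.Injective f)
    (hap : ThreeAPFree (Set.range f)) (hm : ∀ i, 8 * f i + 4 ≤ m) :
    ∃ A B C : Fin k → Finset (ZMod m), IsSTPP A B C ∧ ∀ i, (A i).card = 1 ∧ (B i).card = 2 ∧ (C i).card = 2 := by
  refine ⟨_, _, _, isSTPP_apFam122 m k f hf hap hm, fun i => ⟨card_singleton _, ?_, ?_⟩⟩
  · have hm4 : (4 : ℤ) ≤ m := by have := hm i; omega
    exact card_pairZ _ _ (by norm_num) (by omega)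
  · have hm4 : (4 : ℤ) ≤ m := by have := hm i; omega
    exact card_pairZ _ _ (by norm_num) (by omega)

/-- **`(1,2,2)^k ⊆ ℤ/m` for every `k ≤ rothNumberNat N` and every `m ≥ 8N − 4`.**  Census reading: `onset_T2(k) ≤ 8·n₃(k) − 4`.
[cite: CohnKleinbergSzegedyUmans2005, Def. 5.1] -/
theorem exists_isSTPP_122pow_zmod_of_le_rothNumberNat (N k m : ℕ) (hk : k ≤ rothNumberNat N) (hm : 8 * N ≤ m + 4) :
    ∃ A B C : Fin k → Finset (ZMod m), IsSTPP A B C ∧ ∀ i, (A i).card = 1 ∧ (B i).card = 2 ∧ (C i).card = 2 := by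
  obtain ⟨t, ht, hcard, hap⟩ := rothNumberNat_spec N
  let g : Fin t.card → ℕ := fun i => t.orderEmbOfFin rfl i
  have hg : Function.Injective g := (t.orderEmbOfFin rfl).injective
  have hmem : ∀ i, g i ∈ t := fun i => t.orderEmbOfFin_mem rfl i
  have hkt : k ≤ t.card := hcard ▸ hk
  let f : Fin k → ℕ := fun i => g (Fin.castLE hkt i)
  have hf : Function.Injective f := hg.comp (Fin.castLE_injective hkt)
  have hrange : Set.range f ⊆ (t : Set ℕ) := by rintro _ ⟨i, rfl⟩; exact hmem _
  have hfm : ∀ i, 8 * f i + 4 ≤ m := fun i => by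
    have := ht (hmem (Fin.castLE hkt i)); rw [mem_range] at this
    change 8 * g (Fin.castLE hkt i) + 4 ≤ m
    omega
  exact exists_isSTPP_122pow_zmod_of_threeAPFree f hf (hap.mono hrange) hfm

/-- Transport: **an abelian group with an element of additive order `≥ 8N − 4` admits `(1,2,2)^k` for every `k ≤ rothNumberNat N`.**
[cite: CohnKleinbergSzegedyUmans2005, Def. 5.1] -/
theorem exists_isSTPP_122pow_of_addOrderOf_rothNumberNat {G : Type*} [AddCommGroup G] (N k : ℕ) (g : G)
    (hk : k ≤ rothNumberNat N) (hg : 8 * N ≤ addOrderOf g + 4) :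
    ∃ A B C : Fin k → Finset G, IsSTPP A B C ∧ ∀ i, (A i).card = 1 ∧ (B i).card = 2 ∧ (C i).card = 2 :=
  exists_isSTPP_122_of_injective _ (zmod_lift_zmultiples_injective g)
    (exists_isSTPP_122pow_zmod_of_le_rothNumberNat N k (addOrderOf g) hk hg)

/-- **Cyclic Behrend form `T2(ℤ/m) ≥ m^{1−o(1)}`.** For every `N` and every `m ≥ 8N − 4` there is `k ≥ N·e^{−4√(log N)}` with
`(1,2,2)^k ⊆ ℤ/m`. [cite: CohnKleinbergSzegedyUmans2005, Def. 5.1] -/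
theorem exists_isSTPP_122pow_zmod_behrend (N m : ℕ) (hm : 8 * N ≤ m + 4) :
    ∃ k : ℕ, (N : ℝ) * Real.exp (-4 * √(Real.log N)) ≤ k ∧
      ∃ A B C : Fin k → Finset (ZMod m), IsSTPP A B C ∧ ∀ i, (A i).card = 1 ∧ (B i).card = 2 ∧ (C i).card = 2 :=
  ⟨rothNumberNat N, Behrend.roth_lower_bound, exists_isSTPP_122pow_zmod_of_le_rothNumberNat N _ m le_rfl hm⟩

/-- **The explicit law: for all `t`, all `k ≤ 2^t` and all `m ≥ 4·3^t`, `(1,2,2)^k ⊆ ℤ/m`.**  Census reading: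
`onset_T2(k) ≤ 4·3^{⌈log₂ k⌉} < 12·k^{log₂ 3}`; `k = 2, 4, 8, 16, 32 ↦ m ≥ 12, 36, 108, 324, 972` (kernel onsets `12, 33`; `k = 8`: ray from `100`,
host `96`). [cite: CohnKleinbergSzegedyUmans2005, Def. 5.1] -/
theorem exists_isSTPP_122pow_zmod_of_le_two_pow (t k m : ℕ) (hk : k ≤ 2 ^ t) (hm : 4 * 3 ^ t ≤ m) :
    ∃ A B C : Fin k → Finset (ZMod m), IsSTPP A B C ∧ ∀ i, (A i).card = 1 ∧ (B i).card = 2 ∧ (C i).card = 2 := by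
  refine exists_isSTPP_122pow_zmod_of_threeAPFree (fun i : Fin k => Nat.ofDigits 3 (Nat.digits 2 (i : ℕ))) ?_ ?_ ?_
  · intro i j h
    exact Fin.ext (eq_of_ofDigits_three_digits_two_add i j i (by simp only at h; omega))
  · rintro _ ⟨a, rfl⟩ _ ⟨b, rfl⟩ _ ⟨c, rfl⟩ h
    obtain rfl : a = b := Fin.ext (eq_of_ofDigits_three_digits_two_add a b c h)
    rfl
  · intro i
    have := two_mul_ofDigits_three_digits_two_lt t i (lt_of_lt_of_le i.isLt hk)
    change 8 * Nat.ofDigits 3 (Nat.digits 2 (i : ℕ)) + 4 ≤ m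
    omega

/-- Transport of the explicit law: **an abelian group with an element of additive order `≥ 4·3^t` admits `(1,2,2)^k` for every `k ≤ 2^t`.**
[cite: CohnKleinbergSzegedyUmans2005, Def. 5.1] -/
theorem exists_isSTPP_122pow_of_addOrderOf_two_pow {G : Type*} [AddCommGroup G] (t k : ℕ) (g : G) (hk : k ≤ 2 ^ t)
    (hg : 4 * 3 ^ t ≤ addOrderOf g) :
    ∃ A B C : Fin k → Finset G, IsSTPP A B C ∧ ∀ i, (A i).card = 1 ∧ (B i).card = 2 ∧ (C i).card = 2 :=
  exists_isSTPP_122_of_injective _ (zmod_lift_zmultiples_injective g)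
    (exists_isSTPP_122pow_zmod_of_le_two_pow t k (addOrderOf g) hk hg)

end Summit.MatrixMultiplication.OmegaCensus
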